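import Summits.AtomisticToContinuum.BoseEinsteinCondensation.Theses.BECInfraredBound

/-!
# Birth skeleton (BC3) for the crux `BecDepletionSplit` (stmt-AtomisticToContinuum-9026)

Route `BECInfraredBound` (sub-problem `BoseEinsteinCondensation`), mode-counting glue piece 2/3,
rank 9, "formal risk only" (grounder g26-9: provable-now tsum algebra; refuter g48-12: true as typed,
note `θ⁺ = max θ 0`). Planner skeleton `Lines/birth.lean` (planner-skel-stmt-AtomisticToContinuum-9026-0,
2026-08-17).

**The crux.** For every repulsive finite-range `v`:
(window count for `v` — the conclusion body of `BecWindowCount`: for all `ε ∈ (0,1/4)`, `K > 0`,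
`η > 0` there is `ρ₀ > 0` such that for `0 < ρ < ρ₀`, eventually in `N`, for some `δ > 0`, every
`δ`-near-minimiser `Ψ` of the Dirichlet energy in the box of side `L = (N/ρ)^{1/3}` has
`Σ'_{k ≠ 0, ‖k‖ ≤ K√ρ·L} ⟨φ'_k, γ_Ψ φ'_k⟩ ≤ ηN`)
→ (ultraviolet tail for `v` — the body of `BecUvTail`: some `K > 0`, `θ < 1` with, for every
`ε ∈ (0,1/4)`, the same clause ending in `Σ'_{K√ρ·L < ‖k‖} ⟨φ'_k, γ_Ψ φ'_k⟩ ≤ θN`)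
→ inner-box depletion: some `θ' < 1` with, for every `ε ∈ (0,1/4)`, the same clause ending in
`Σ'_{k ≠ 0} ⟨φ'_k, γ_Ψ φ'_k⟩ ≤ θ'N`.
Here `φ'_k = L'^{-3/2} e^{2πi k·x/L'} 1_{Λ'}` are the inner-box plane waves, `Λ' = (εL, L−εL)³`,
`L' = (1−2ε)L`, `‖k‖` the sup norm on `ℤ³ ⊂ ℝ³`, and all sums are unconditional `ℝ≥0∞`-valued
`tsum`s over subtypes of `Fin 3 → ℤ`.

**The cut (three named stubs = the three named risks of the item's `why it might fail`).**

* `stub_latticeTsumSplit` — THE TSUM SPLIT: for every `f : (Fin 3 → ℤ) → ℝ≥0∞` and every real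
  threshold `R`, `Σ'_{k ≠ 0} f k ≤ Σ'_{k ≠ 0, ‖k‖ ≤ R} f k + Σ'_{R < ‖k‖} f k`.
  True for every `R` (for `R ≥ 0` it is the equality "tsum over a disjoint union of subtypes";
  for `R < 0` the tail subtype also contains `k = 0`, and `≤` survives): `{k ≠ 0} ⊆ window ∪ tail`
  by `le_or_lt`, `ENNReal.tsum_mono_subtype`, `ENNReal.tsum_union_le`; no summability issues in
  `ℝ≥0∞`. Size S.
* `stub_thresholdCombine` — THE THRESHOLD ARITHMETIC WITH THE `θ ≤ 0` CORNER: for every `θ < 1`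
  there are `η > 0` and `θ' < 1` such that for all `N : ℕ` and `a b : ℝ≥0∞`,
  `a ≤ ofReal (ηN) → b ≤ ofReal (θN) → a + b ≤ ofReal (θ'N)`.
  Witnesses: `θ⁺ := max θ 0 ∈ [0,1)`, `η := (1−θ⁺)/2`, `θ' := (1+θ⁺)/2`; then
  `ofReal (ηN) + ofReal (θN) ≤ ofReal (ηN) + ofReal (θ⁺N) = ofReal ((η+θ⁺)N) = ofReal (θ'N)`
  (`ENNReal.ofReal_add` needs both summands `≥ 0` — exactly why the naive `η = (1−θ)/2`,
  `θ' = (1+θ)/2` of the item text fails for `θ < 0`, where `ofReal (θN) = 0`; refuter g48-12).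
  Size S.
* `stub_nearMinCombine` — INTERSECTING TWO NEAR-MINIMISER CLAUSES: for a fixed `v` and predicates
  `P Q R ρ N Ψ` with `P → Q → R` pointwise, the clauses
  `∃ ρ₀ > 0, ∀ ρ ∈ (0,ρ₀), ∀ᶠ N, ∃ δ > 0, ∀ Ψ, energy v Ψ ≤ E₀ + δ → P ρ N Ψ` and the same for `Q`
  give the same for `R`: `ρ₀ := min`, `Filter.Eventually.and`, `δ := min δ₁ δ₂` (a `δ`-near-minimiser
  is a `δᵢ`-near-minimiser by monotonicity of `E₀ + ·`). This is the route's recurring glue pattern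
  (the prover of `BecDepletionCounting`, stmt-9034, needs the identical step for depletion ∧ shell
  mass), so it is cut as a reusable lemma. Size S.

The three stub statements are spelled out EXPLICITLY and fully qualified in the `stub_*` theorems (so
the registered signatures re-elaborate standalone), and once more, verbatim, as the named propositions
`Sig.stub_<name>` that the composition takes as hypotheses BY NAME (skeleton-audit convention).

**The composition** `BecDepletionSplit_of : Sig.stub_latticeTsumSplit → Sig.stub_thresholdCombine →
Sig.stub_nearMinCombine → BecDepletionSplit` is PROVED below (no `sorry`, axioms
`propext / Classical.choice / Quot.sound`): take `K, θ` from the tail hypothesis, `η, θ'` from the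
threshold stub, instantiate the window count at `(ε, K, η)` and the tail at `ε`, and combine the two
clauses with the near-minimiser combinator, the pointwise implication being the tsum split (with
`f k := ⟨φ'_k, γ_Ψ φ'_k⟩`, `R := K√ρ·L`) followed by the threshold arithmetic. The final `example`
plugs the three registered stubs in (type-checks, so the explicit stub statements and the `Sig.*`
propositions agree definitionally). Direct `sorry` only inside the three `stub_*`; the conclusion is
the route decl `Summit.AtomisticToContinuum.BoseEinsteinCondensation.Theses.BECInfraredBound.BecDepletionSplit`
BY NAME.

Disproof used: none on file (no `Disproof.lean`, no `Negative/` lemma, `ledger crux ls` = no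
workfiles at registration; `ledger negatives --problem AtomisticToContinuum` has no statement about
inner-box occupations). BC3 probes (seat folder `bc/probe_stub_*.lean`, table in `Lines/birth.md`):
for each stub, `stub → BecDepletionSplit` and `stub → _root_.BoseEinsteinCondensation` by `exact?`,
`simpa`, `simpa [Sig…]`, `(unfold; simpa)`, `aesop`, `first | exact? | simpa | aesop` all FAIL, and
`exact?` does not find any stub in the library — no stub is cheaply the crux or the conjunct (each is
a generic lemma: a lattice-sum inequality, an `ℝ≥0∞` arithmetic fact, a filter/quantifier combinator).

References: LSSY2005 Ch. 5 (5.1)–(5.2) and Ch. 11 (11.26)–(11.27) (mode counting after an infrared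
bound); DysonLiebSimon1978 §1 (sum rule + infrared bound ⇒ condensation by counting).
-/

noncomputable section

open Filter
open scoped ENNReal NNReal BigOperators

namespace Summit.AtomisticToContinuum.BoseEinsteinCondensation.Cruxes.BecDepletionSplit.Birth

open Literature.MathematicalPhysics.QuantumManyBody.BoseGas
open Summit.AtomisticToContinuum.BoseEinsteinCondensation.Theses.BECInfraredBound (BecDepletionSplit)

/-! ## Stub signatures as named propositions (verbatim the statements of the `stub_*` theorems) -/

/-- Named form of the statement of `stub_latticeTsumSplit` (lattice tsum split, any real threshold).
[cite: LSSY2005, Ch. 11 (11.26)–(11.27)] -/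
def Sig.stub_latticeTsumSplit : Prop :=
    ∀ (f : (Fin 3 → ℤ) → ENNReal) (R : ℝ),
      ∑' k : {k : Fin 3 → ℤ // k ≠ 0}, f k.1 ≤
        (∑' k : {k : Fin 3 → ℤ // k ≠ 0 ∧ ‖(fun j => (k j : ℝ))‖ ≤ R}, f k.1) +
          ∑' k : {k : Fin 3 → ℤ // R < ‖(fun j => (k j : ℝ))‖}, f k.1

/-- Named form of the statement of `stub_thresholdCombine` (`θ' < 1` bookkeeping with the corner
`θ ≤ 0`). [folklore] -/
def Sig.stub_thresholdCombine : Prop :=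
    ∀ θ : ℝ, θ < 1 → ∃ η : ℝ, 0 < η ∧ ∃ θ' : ℝ, θ' < 1 ∧ ∀ (N : ℕ) (a b : ENNReal),
      a ≤ ENNReal.ofReal (η * N) → b ≤ ENNReal.ofReal (θ * N) → a + b ≤ ENNReal.ofReal (θ' * N)

/-- Named form of the statement of `stub_nearMinCombine` (two near-minimiser clauses combine).
[folklore] -/
def Sig.stub_nearMinCombine : Prop :=
    ∀ (v : ℝ → ENNReal)
      (P Q R : (ρ : ℝ) → (N : ℕ) → Literature.MathematicalPhysics.QuantumManyBody.BoseGas.TrialState N (Literature.MathematicalPhysics.QuantumManyBody.BoseGas.sideLength ρ N) → Prop),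
      (∀ ρ N Ψ, P ρ N Ψ → Q ρ N Ψ → R ρ N Ψ) →
      (∃ ρ₀ : ℝ, 0 < ρ₀ ∧ ∀ ρ : ℝ, 0 < ρ → ρ < ρ₀ → ∀ᶠ N : ℕ in Filter.atTop, ∃ δ : ENNReal, 0 < δ ∧
        ∀ Ψ : Literature.MathematicalPhysics.QuantumManyBody.BoseGas.TrialState N (Literature.MathematicalPhysics.QuantumManyBody.BoseGas.sideLength ρ N),
          Literature.MathematicalPhysics.QuantumManyBody.BoseGas.energy v Ψ ≤
              Literature.MathematicalPhysics.QuantumManyBody.BoseGas.groundStateEnergy v N (Literature.MathematicalPhysics.QuantumManyBody.BoseGas.sideLength ρ N) + δ →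
            P ρ N Ψ) →
      (∃ ρ₀ : ℝ, 0 < ρ₀ ∧ ∀ ρ : ℝ, 0 < ρ → ρ < ρ₀ → ∀ᶠ N : ℕ in Filter.atTop, ∃ δ : ENNReal, 0 < δ ∧
        ∀ Ψ : Literature.MathematicalPhysics.QuantumManyBody.BoseGas.TrialState N (Literature.MathematicalPhysics.QuantumManyBody.BoseGas.sideLength ρ N),
          Literature.MathematicalPhysics.QuantumManyBody.BoseGas.energy v Ψ ≤
              Literature.MathematicalPhysics.QuantumManyBody.BoseGas.groundStateEnergy v N (Literature.MathematicalPhysics.QuantumManyBody.BoseGas.sideLength ρ N) + δ →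
            Q ρ N Ψ) →
      ∃ ρ₀ : ℝ, 0 < ρ₀ ∧ ∀ ρ : ℝ, 0 < ρ → ρ < ρ₀ → ∀ᶠ N : ℕ in Filter.atTop, ∃ δ : ENNReal, 0 < δ ∧
        ∀ Ψ : Literature.MathematicalPhysics.QuantumManyBody.BoseGas.TrialState N (Literature.MathematicalPhysics.QuantumManyBody.BoseGas.sideLength ρ N),
          Literature.MathematicalPhysics.QuantumManyBody.BoseGas.energy v Ψ ≤
              Literature.MathematicalPhysics.QuantumManyBody.BoseGas.groundStateEnergy v N (Literature.MathematicalPhysics.QuantumManyBody.BoseGas.sideLength ρ N) + δ →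
            R ρ N Ψ

/-! ## Registered stubs (explicit, fully qualified statements; `sorry` lives only here) -/

/-- **Registered stub 1 — lattice tsum split.** For every `f : ℤ³ → ℝ≥0∞` and every real `R`, the
sum over `k ≠ 0` is at most the window sum (`k ≠ 0`, `‖k‖ ≤ R`, sup norm in `ℝ³`) plus the tail sum
(`R < ‖k‖`). Plausibly true: `{k ≠ 0} ⊆ {k ≠ 0 ∧ ‖k‖ ≤ R} ∪ {R < ‖k‖}` (`le_or_lt`), then
`ENNReal.tsum_mono_subtype` and `ENNReal.tsum_union_le`. Size S. [cite: LSSY2005, Ch. 11 (11.26)–(11.27)] -/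
theorem stub_latticeTsumSplit :
    ∀ (f : (Fin 3 → ℤ) → ENNReal) (R : ℝ),
      ∑' k : {k : Fin 3 → ℤ // k ≠ 0}, f k.1 ≤
        (∑' k : {k : Fin 3 → ℤ // k ≠ 0 ∧ ‖(fun j => (k j : ℝ))‖ ≤ R}, f k.1) +
          ∑' k : {k : Fin 3 → ℤ // R < ‖(fun j => (k j : ℝ))‖}, f k.1 := by
  sorry

/-- **Registered stub 2 — threshold arithmetic with the `θ ≤ 0` corner.** Plausibly true: witnesses
`η = (1 - max θ 0)/2`, `θ' = (1 + max θ 0)/2`, via `ENNReal.ofReal_le_ofReal`, `ENNReal.ofReal_add`.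
Size S. [folklore] -/
theorem stub_thresholdCombine :
    ∀ θ : ℝ, θ < 1 → ∃ η : ℝ, 0 < η ∧ ∃ θ' : ℝ, θ' < 1 ∧ ∀ (N : ℕ) (a b : ENNReal),
      a ≤ ENNReal.ofReal (η * N) → b ≤ ENNReal.ofReal (θ * N) → a + b ≤ ENNReal.ofReal (θ' * N) := by
  sorry

/-- **Registered stub 3 — near-minimiser clause combinator.** Plausibly true: `min` of the density
thresholds, `Filter.Eventually.and`/`.mono`, `min` of the two `δ`'s (`lt_min`) and
`add_le_add_left (min_le_…)` on `E₀ + δ`. Size S. [folklore] -/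
theorem stub_nearMinCombine :
    ∀ (v : ℝ → ENNReal)
      (P Q R : (ρ : ℝ) → (N : ℕ) → Literature.MathematicalPhysics.QuantumManyBody.BoseGas.TrialState N (Literature.MathematicalPhysics.QuantumManyBody.BoseGas.sideLength ρ N) → Prop),
      (∀ ρ N Ψ, P ρ N Ψ → Q ρ N Ψ → R ρ N Ψ) →
      (∃ ρ₀ : ℝ, 0 < ρ₀ ∧ ∀ ρ : ℝ, 0 < ρ → ρ < ρ₀ → ∀ᶠ N : ℕ in Filter.atTop, ∃ δ : ENNReal, 0 < δ ∧
        ∀ Ψ : Literature.MathematicalPhysics.QuantumManyBody.BoseGas.TrialState N (Literature.MathematicalPhysics.QuantumManyBody.BoseGas.sideLength ρ N),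
          Literature.MathematicalPhysics.QuantumManyBody.BoseGas.energy v Ψ ≤
              Literature.MathematicalPhysics.QuantumManyBody.BoseGas.groundStateEnergy v N (Literature.MathematicalPhysics.QuantumManyBody.BoseGas.sideLength ρ N) + δ →
            P ρ N Ψ) →
      (∃ ρ₀ : ℝ, 0 < ρ₀ ∧ ∀ ρ : ℝ, 0 < ρ → ρ < ρ₀ → ∀ᶠ N : ℕ in Filter.atTop, ∃ δ : ENNReal, 0 < δ ∧
        ∀ Ψ : Literature.MathematicalPhysics.QuantumManyBody.BoseGas.TrialState N (Literature.MathematicalPhysics.QuantumManyBody.BoseGas.sideLength ρ N),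
          Literature.MathematicalPhysics.QuantumManyBody.BoseGas.energy v Ψ ≤
              Literature.MathematicalPhysics.QuantumManyBody.BoseGas.groundStateEnergy v N (Literature.MathematicalPhysics.QuantumManyBody.BoseGas.sideLength ρ N) + δ →
            Q ρ N Ψ) →
      ∃ ρ₀ : ℝ, 0 < ρ₀ ∧ ∀ ρ : ℝ, 0 < ρ → ρ < ρ₀ → ∀ᶠ N : ℕ in Filter.atTop, ∃ δ : ENNReal, 0 < δ ∧
        ∀ Ψ : Literature.MathematicalPhysics.QuantumManyBody.BoseGas.TrialState N (Literature.MathematicalPhysics.QuantumManyBody.BoseGas.sideLength ρ N),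
          Literature.MathematicalPhysics.QuantumManyBody.BoseGas.energy v Ψ ≤
              Literature.MathematicalPhysics.QuantumManyBody.BoseGas.groundStateEnergy v N (Literature.MathematicalPhysics.QuantumManyBody.BoseGas.sideLength ρ N) + δ →
            R ρ N Ψ := by
  sorry

/-! ## Abbreviations used only inside the composition proof -/

/-- The inner box `Λ'_ε = (εL, L - εL)³` (verbatim the set in the crux). [cite: LSSY2005, Ch. 5] -/
abbrev innerBox (ε L : ℝ) : Set (EuclideanSpace ℝ (Fin 3)) :=
  {x : EuclideanSpace ℝ (Fin 3) | ∀ j, x j ∈ Set.Ioo (ε * L) (L - ε * L)}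

/-- The inner-box plane wave `φ'_k = L'^{-3/2} e^{2πi k·x/L'} 1_{Λ'}`, `L' = (1-2ε)L` (verbatim the
mode in the crux). [cite: LSSY2005, Ch. 5] -/
abbrev innerMode (ε L : ℝ) (k : Fin 3 → ℤ) : EuclideanSpace ℝ (Fin 3) → ℂ :=
  (innerBox ε L).indicator fun x =>
    ((Real.sqrt (((1 - 2 * ε) * L) ^ 3))⁻¹ : ℂ) *
      Complex.exp (Complex.I * ↑(2 * Real.pi / ((1 - 2 * ε) * L) * ∑ j, (k j : ℝ) * x j))

/-! ## The composition: the crux BY NAME from the three stub signatures -/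

/-- **Composition (kernel-checked, no `sorry`).** The three stub signatures imply the route decl
`BecDepletionSplit` by name: `K, θ` from the tail hypothesis; `η, θ'` from the threshold stub;
window count at `(ε, K, η)`, tail at `ε`; clauses combined by the near-minimiser combinator with
the pointwise step "tsum split, then add the two bounds". [cite: LSSY2005, Ch. 11 (11.26)–(11.27)] -/
theorem BecDepletionSplit_of :
    Sig.stub_latticeTsumSplit → Sig.stub_thresholdCombine → Sig.stub_nearMinCombine →
      BecDepletionSplit := by
  intro hsplit hthr hcomb v hv hW hU
  obtain ⟨K, hK, θ, hθ, hUε⟩ := hU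
  obtain ⟨η, hη, θ', hθ', hadd⟩ := hthr θ hθ
  refine ⟨θ', hθ', fun ε hε hε' => ?_⟩
  refine hcomb v _ _ _ ?_ (hW ε hε hε' K hK η hη) (hUε ε hε hε')
  intro ρ N Ψ hp hq
  exact le_trans
    (hsplit (fun k => occupation N (innerMode ε (sideLength ρ N) k) Ψ.ψ)
      (K * Real.sqrt ρ * sideLength ρ N))
    (hadd N _ _ hp hq)

/-- Plug-in check (not a named theorem, so the skeleton audit sees exactly one by-name candidate):
the registered stubs feed the composition, i.e. the explicit stub statements and the `Sig.*`
propositions agree and the crux follows from the three stubs. [folklore] -/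
example : BecDepletionSplit :=
  BecDepletionSplit_of stub_latticeTsumSplit stub_thresholdCombine stub_nearMinCombine

end Summit.AtomisticToContinuum.BoseEinsteinCondensation.Cruxes.BecDepletionSplit.Birth

end
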